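import Summits.HodgeConjecture.CorCM.MumfordTateRankSurfaces
import Summits.HodgeConjecture.CorCM.MumfordTateRankQuaternionLefschetzDimension
import Summits.HodgeConjecture.CorCM.LefschetzAlgebraCMField
import HarnessLib

/-!
# Hodge = Lefschetz for simple complex abelian surfaces (at the level of Lie algebras)

Sub-problem `CorCM` of `HodgeConjecture` (cell `pub-hodgecm2`, count-neutral Mumford–Tate-rank lane of seat `b27`; theorems only,
no new definition, no named fact; nothing here uses or asserts `HC_CM`).  For a SIMPLE complex abelian surface `B` and every
polarization `ψ` of `H¹(B, ℚ)`, **`Lie Hg(H¹B) = Lef(ψ) = C(End_Hdg(H¹B)) ∩ 𝔰𝔭(ψ)`** provided `End⁰B ≠ ℚ` or `dim MT(H¹B) = 11`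
(Moonen–Zarhin (2.2): `Hg = Sp_D(V, φ)` in all four cases I(1), I(2), II(1), IV(2,1); the residual hypothesis excludes only the
phantom «`End⁰B = ℚ`, `t = 7`», which the tree's rank ladder has not yet ruled out):

* `End⁰B = ℚ`, `t = 11`: `Lef(ψ) = 𝔰𝔭₄` has dimension `10 = dim Lie Hg` (`CorCM/MumfordTateRankTrivialEndomorphisms`);
* `End⁰B` real quadratic: RM of relative dimension one (`CorCM/LefschetzAlgebraTotallyRealField`);
* `End⁰B` quaternion (type II(1)): `dim Lef = 1·1·3 = 3 = dim Lie Hg` (`CorCM/MumfordTateRankQuaternionLefschetzDimension`);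
* `End⁰B` quartic CM field: simple CM surface, nondegenerate (`CorCM/LefschetzAlgebraCMField`).

Also the Lefschetz ranks themselves: `dim Lef(ψ) = 10, 6, 2, 3` for the four types (`finrank_lefschetz_of_isSimple_surface`).

## References
* [MoonenZarhin1999LowDim] B. Moonen, Yu. G. Zarhin, *Hodge classes on abelian varieties of low dimension*, Math. Ann. 315 (1999), §2 (2.2).
* [Milne1999LefschetzClasses] J. S. Milne, *Lefschetz classes on abelian varieties*, Duke Math. J. 96 (1999), §2 and Summary.
-/

noncomputable section

namespace Summit.HodgeConjecture.CorCM

open scoped TensorProduct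
open CategoryTheory CategoryTheory.Limits Module NumberField
open Literature.AlgebraicGeometry.Motives
open Literature.AlgebraicGeometry.Motives.AbelianVariety
open Literature.AlgebraicGeometry.Motives.HodgeStructure
open Literature.AlgebraicGeometry.HodgeTheory
open Literature.AlgebraicGeometry.ComplexMultiplication (bettiRep EndField EndField.toEndAlgebra isOfCMType_of_isField
  nontrivial_endAlgebra_of_dim_pos)
open Literature.AlgebraicGeometry.Milne1999 (IsOfCMType)
open Literature.NumberTheory.Automorphic (IsQuaternionAlgebra)
open Literature.RingTheory.CentralSimple
open Literature.Algebra.Lie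

variable [HodgeTensorFacts.{0, 0}]

/-- **Hodge = Lefschetz for simple abelian surfaces** with `End⁰B ≠ ℚ` or `dim MT(H¹B) = 11`: for every polarization `ψ`,
`Lie Hg(H¹B) = C(End_Hdg(H¹B)) ∩ 𝔰𝔭(ψ)`. [cite: MoonenZarhin1999LowDim, §2 (2.2)] [cite: Milne1999LefschetzClasses, §2 and Summary] -/
theorem hodgeLie_eq_lefschetz_of_isSimple_surface {B : AbelianVariety ℂ} {k : ℕ} (hB : IsSmoothProjective k B.X) (hBs : B.IsSimple)
    (hB2 : B.dim = 2) [Module.Finite ℚ (bettiCohomology B.X 1)] (ψ : (BettiUniverse.hodge exists_isReal_hodgeModel_holds hB 1).Polarization)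
    (h : Module.finrank ℚ B.endAlgebra ≠ 1 ∨ (BettiUniverse.hodge exists_isReal_hodgeModel_holds hB 1).mtRank = 11) :
    (BettiUniverse.hodge exists_isReal_hodgeModel_holds hB 1).hodgeLie =
      Subalgebra.toSubmodule (Subalgebra.centralizer ℚ
          ((BettiUniverse.hodge exists_isReal_hodgeModel_holds hB 1).endAlg : Set (Module.End ℚ (bettiCohomology B.X 1)))) ⊓
        ψ.form.skewAdjointSubmodule := by
  classical
  have hk : B.dim = k := schemeDim_eq_holds hB
  subst hk
  have h0 : 0 < B.dim := by omega
  have ht := mtRank_hodge_one_eq_finrank_hodgeLie_add_one hB h0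
  rcases AbelianVariety.finrank_endAlgebra_eq_of_isSimple_surface hBs hB2 with h1 | h2 | h4
  · -- type I(1): `t = 11`, `Lef(ψ) = 𝔰𝔭₄` of dimension `10`
    have h11 : (BettiUniverse.hodge exists_isReal_hodgeModel_holds hB 1).mtRank = 11 := h.resolve_left (fun h' => h' h1)
    have hflip : ψ.form.flip = -ψ.form := by
      rw [ψ.flip_form, show (((1 : ℕ) : ℤ).negOnePow : ℤˣ) = -1 from Int.negOnePow_one, Units.val_neg, Units.val_one,
        neg_one_zsmul]
    have hs := SymplecticDimension.two_mul_finrank_skewAdjointSubmodule_of_flip_eq_neg ψ.form ψ.nondegenerate hflip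
    rw [finrank_bettiCohomology_one_eq_two_mul_dim B] at hs
    have e20 : 2 * B.dim * (2 * B.dim + 1) = 20 := by rw [hB2]
    refine Submodule.eq_of_le_of_finrank_eq (hodgeLie_hodge_one_le_lefschetz hB ψ) ?_
    rw [lefschetz_eq_skewAdjoint_of_finrank_endAlgebra_eq_one hB h1 ψ]
    omega
  · -- type I(2): real multiplication of relative dimension one
    have hF : IsField B.endAlgebra := AbelianVariety.isField_endAlgebra_of_isSimple_of_finrank_eq_two hBs h0 h2
    haveI : IsTotallyReal (EndField B hF) := AbelianVariety.isTotallyReal_endField_of_surface hB2 h2 hF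
    letI : Algebra (EndField B hF) B.endAlgebra :=
      (EndField.toEndAlgebra hF).toRingHom.toAlgebra' fun c x => hF.mul_comm _ _
    haveI : IsScalarTower ℚ (EndField B hF) B.endAlgebra := IsScalarTower.of_algebraMap_eq' (Subsingleton.elim _ _)
    have hK : Function.Bijective (algebraMap (EndField B hF) B.endAlgebra) := (EndField.toEndAlgebra hF).bijective
    exact hodgeLie_hodge_one_eq_lefschetz_of_field_of_dim_eq hB hK (by rw [EndField.finrank_eq, h2, hB2]) ψ
  · by_cases hc : ∀ x y : B.endAlgebra, x * y = y * x
    · -- type IV(2,1): a simple CM surface is nondegenerate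
      have hF : IsField B.endAlgebra := AbelianVariety.isField_endAlgebra_of_isSimple_of_comm hBs h0 hc
      have hFtop : IsField (⊤ : Subalgebra ℚ B.endAlgebra) :=
        MulEquiv.isField hF (Subalgebra.topEquiv : (⊤ : Subalgebra ℚ B.endAlgebra) ≃ₐ[ℚ] B.endAlgebra).toMulEquiv
      have hdeg : Module.finrank ℚ (⊤ : Subalgebra ℚ B.endAlgebra) = 2 * B.dim := by
        rw [← Subalgebra.finrank_toSubmodule, Algebra.top_toSubmodule, finrank_top, h4, hB2]
      have hcm : IsOfCMType B := isOfCMType_of_isField ⊤ hFtop hdeg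
      exact hodgeLie_eq_lefschetz_of_isSimple_of_isOfCMType_of_dim_le_three_or_prime hBs h0 hcm (Or.inl (by omega)) ψ
    · -- type II(1): indefinite quaternion algebra over `ℚ`
      push Not at hc
      obtain ⟨x, y, hxy⟩ := hc
      haveI : IsQuaternionAlgebra ℚ B.endAlgebra := AbelianVariety.isQuaternionAlgebra_endAlgebra_of_isSimple hBs h0 h4 ⟨x, y, hxy⟩
      have hind : IsTotallyIndefinite ℚ B.endAlgebra :=
        AbelianVariety.isTotallyIndefinite_of_isSimple_of_dim_eq (K := ℚ) hBs (by rw [Module.finrank_self, hB2])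
      have h4' := (exists_mul_ne_iff_mtRank_hodge_one_eq_four_of_isSimple_surface hB hBs hB2).1 ⟨x, y, hxy⟩
      refine (hodgeLie_hodge_one_eq_lefschetz_iff_of_isTotallyIndefinite_centre hB hBs (K := ℚ) hind (m := 1)
        (by rw [Module.finrank_self, hB2]) ψ).2 ?_
      rw [Module.finrank_self]
      omega

/-- **Hodge = Lefschetz for every simple abelian surface with `End⁰B ≠ ℚ`.** [cite: MoonenZarhin1999LowDim, §2 (2.2)] -/
theorem hodgeLie_eq_lefschetz_of_isSimple_surface_of_finrank_endAlgebra_ne_one {B : AbelianVariety ℂ} {k : ℕ}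
    (hB : IsSmoothProjective k B.X) (hBs : B.IsSimple) (hB2 : B.dim = 2) (hE : Module.finrank ℚ B.endAlgebra ≠ 1)
    [Module.Finite ℚ (bettiCohomology B.X 1)] (ψ : (BettiUniverse.hodge exists_isReal_hodgeModel_holds hB 1).Polarization) :
    (BettiUniverse.hodge exists_isReal_hodgeModel_holds hB 1).hodgeLie =
      Subalgebra.toSubmodule (Subalgebra.centralizer ℚ
          ((BettiUniverse.hodge exists_isReal_hodgeModel_holds hB 1).endAlg : Set (Module.End ℚ (bettiCohomology B.X 1)))) ⊓
        ψ.form.skewAdjointSubmodule :=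
  hodgeLie_eq_lefschetz_of_isSimple_surface hB hBs hB2 ψ (Or.inl hE)

/-- **Hodge = Lefschetz for every abelian surface with `dim MT(H¹X) = 11`** (then `X` is simple with `End⁰X = ℚ` and
`Lie Hg = 𝔰𝔭₄`). [cite: MoonenZarhin1999LowDim, §2 (2.2)] -/
theorem hodgeLie_eq_lefschetz_of_surface_of_mtRank_eq_eleven {X : AbelianVariety ℂ} {k : ℕ} (hX : IsSmoothProjective k X.X)
    (hX2 : X.dim = 2) [Module.Finite ℚ (bettiCohomology X.X 1)]
    (ψ : (BettiUniverse.hodge exists_isReal_hodgeModel_holds hX 1).Polarization)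
    (h11 : (BettiUniverse.hodge exists_isReal_hodgeModel_holds hX 1).mtRank = 11) :
    (BettiUniverse.hodge exists_isReal_hodgeModel_holds hX 1).hodgeLie =
      Subalgebra.toSubmodule (Subalgebra.centralizer ℚ
          ((BettiUniverse.hodge exists_isReal_hodgeModel_holds hX 1).endAlg : Set (Module.End ℚ (bettiCohomology X.X 1)))) ⊓
        ψ.form.skewAdjointSubmodule :=
  hodgeLie_eq_lefschetz_of_isSimple_surface hX
    ((isSimple_iff_of_surface_of_mtRank hX hX2).1 h11) hX2 ψ (Or.inr h11)

/-- **The Lefschetz rank of a simple abelian surface, by endomorphism type**: `dim Lef(ψ) = 10` (`End⁰B = ℚ`, `𝔰𝔭₄`), `6` (real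
quadratic, `Res sl₂`), `2` (quartic CM field, the torus) or `3` (quaternion, `C(D) ∩ 𝔰𝔭₄`) — compare `dim Lie Hg = t − 1 ∈ {6 or 10, 6, 2, 3}`
(`CorCM/MumfordTateRankSimpleSurfaces`). [cite: MoonenZarhin1999LowDim, §2 (2.2)] [cite: Milne1999LefschetzClasses, §2 and Summary] -/
theorem finrank_lefschetz_of_isSimple_surface {B : AbelianVariety ℂ} {k : ℕ} (hB : IsSmoothProjective k B.X) (hBs : B.IsSimple)
    (hB2 : B.dim = 2) [Module.Finite ℚ (bettiCohomology B.X 1)] (ψ : (BettiUniverse.hodge exists_isReal_hodgeModel_holds hB 1).Polarization) :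
    (Module.finrank ℚ B.endAlgebra = 1 ∧ Module.finrank ℚ ↥(Subalgebra.toSubmodule (Subalgebra.centralizer ℚ
          ((BettiUniverse.hodge exists_isReal_hodgeModel_holds hB 1).endAlg : Set (Module.End ℚ (bettiCohomology B.X 1)))) ⊓
        ψ.form.skewAdjointSubmodule) = 10) ∨
      (Module.finrank ℚ B.endAlgebra = 2 ∧ Module.finrank ℚ ↥(Subalgebra.toSubmodule (Subalgebra.centralizer ℚ
          ((BettiUniverse.hodge exists_isReal_hodgeModel_holds hB 1).endAlg : Set (Module.End ℚ (bettiCohomology B.X 1)))) ⊓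
        ψ.form.skewAdjointSubmodule) = 6) ∨
      (Module.finrank ℚ B.endAlgebra = 4 ∧ (∀ x y : B.endAlgebra, x * y = y * x) ∧ Module.finrank ℚ ↥(Subalgebra.toSubmodule (Subalgebra.centralizer ℚ
          ((BettiUniverse.hodge exists_isReal_hodgeModel_holds hB 1).endAlg : Set (Module.End ℚ (bettiCohomology B.X 1)))) ⊓
        ψ.form.skewAdjointSubmodule) = 2) ∨
      (Module.finrank ℚ B.endAlgebra = 4 ∧ (∃ x y : B.endAlgebra, x * y ≠ y * x) ∧ Module.finrank ℚ ↥(Subalgebra.toSubmodule (Subalgebra.centralizer ℚ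
          ((BettiUniverse.hodge exists_isReal_hodgeModel_holds hB 1).endAlg : Set (Module.End ℚ (bettiCohomology B.X 1)))) ⊓
        ψ.form.skewAdjointSubmodule) = 3) := by
  classical
  have hk : B.dim = k := schemeDim_eq_holds hB
  subst hk
  have h0 : 0 < B.dim := by omega
  rcases AbelianVariety.finrank_endAlgebra_eq_of_isSimple_surface hBs hB2 with h1 | h2 | h4
  · refine Or.inl ⟨h1, ?_⟩
    have hflip : ψ.form.flip = -ψ.form := by
      rw [ψ.flip_form, show (((1 : ℕ) : ℤ).negOnePow : ℤˣ) = -1 from Int.negOnePow_one, Units.val_neg, Units.val_one,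
        neg_one_zsmul]
    have hs := SymplecticDimension.two_mul_finrank_skewAdjointSubmodule_of_flip_eq_neg ψ.form ψ.nondegenerate hflip
    rw [finrank_bettiCohomology_one_eq_two_mul_dim B] at hs
    have e20 : 2 * B.dim * (2 * B.dim + 1) = 20 := by rw [hB2]
    rw [lefschetz_eq_skewAdjoint_of_finrank_endAlgebra_eq_one hB h1 ψ]
    omega
  · refine Or.inr (Or.inl ⟨h2, ?_⟩)
    have hF : IsField B.endAlgebra := AbelianVariety.isField_endAlgebra_of_isSimple_of_finrank_eq_two hBs h0 h2
    haveI : IsTotallyReal (EndField B hF) := AbelianVariety.isTotallyReal_endField_of_surface hB2 h2 hF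
    letI : Algebra (EndField B hF) B.endAlgebra :=
      (EndField.toEndAlgebra hF).toRingHom.toAlgebra' fun c x => hF.mul_comm _ _
    haveI : IsScalarTower ℚ (EndField B hF) B.endAlgebra := IsScalarTower.of_algebraMap_eq' (Subsingleton.elim _ _)
    have hK : Function.Bijective (algebraMap (EndField B hF) B.endAlgebra) := (EndField.toEndAlgebra hF).bijective
    have hdeg : Module.finrank ℚ (EndField B hF) = 2 := by rw [EndField.finrank_eq, h2]
    have h := finrank_lefschetz_eq_of_field hB hK (m := 1) (by rw [hdeg, hB2]) ψ
    rw [hdeg] at h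
    omega
  · by_cases hc : ∀ x y : B.endAlgebra, x * y = y * x
    · refine Or.inr (Or.inr (Or.inl ⟨h4, hc, ?_⟩))
      have hF : IsField B.endAlgebra := AbelianVariety.isField_endAlgebra_of_isSimple_of_comm hBs h0 hc
      have hFtop : IsField (⊤ : Subalgebra ℚ B.endAlgebra) :=
        MulEquiv.isField hF (Subalgebra.topEquiv : (⊤ : Subalgebra ℚ B.endAlgebra) ≃ₐ[ℚ] B.endAlgebra).toMulEquiv
      have hdeg : Module.finrank ℚ (⊤ : Subalgebra ℚ B.endAlgebra) = 2 * B.dim := by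
        rw [← Subalgebra.finrank_toSubmodule, Algebra.top_toSubmodule, finrank_top, h4, hB2]
      have hcm : IsOfCMType B := isOfCMType_of_isField ⊤ hFtop hdeg
      have h := (hodgeLie_eq_lefschetz_iff_of_isSimple_of_isOfCMType hBs h0 hcm ψ).1
      omega
    · push Not at hc
      obtain ⟨x, y, hxy⟩ := hc
      refine Or.inr (Or.inr (Or.inr ⟨h4, ⟨x, y, hxy⟩, ?_⟩))
      haveI : IsQuaternionAlgebra ℚ B.endAlgebra := AbelianVariety.isQuaternionAlgebra_endAlgebra_of_isSimple hBs h0 h4 ⟨x, y, hxy⟩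
      have hind : IsTotallyIndefinite ℚ B.endAlgebra :=
        AbelianVariety.isTotallyIndefinite_of_isSimple_of_dim_eq (K := ℚ) hBs (by rw [Module.finrank_self, hB2])
      have h := finrank_lefschetz_eq_of_isTotallyIndefinite_centre hB hBs (K := ℚ) hind (m := 1)
        (by rw [Module.finrank_self, hB2]) ψ
      rw [Module.finrank_self] at h
      omega

end Summit.HodgeConjecture.CorCM

end
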